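import Literature.Analysis.FluidPDE.LocalEnergyWeakContinuity
import Literature.Analysis.FluidPDE.NSSereginMildProp151
import Literature.Analysis.FluidPDE.JiaSverak2014SlabInitialLEI
import Literature.Analysis.FluidPDE.WholeSpaceIBP
import Literature.Analysis.FluidPDE.EnstrophySplitting
import HarnessLib

/-!
# Tools for the initial condition of limits of local energy solutions

Analysis/FluidPDE theorem file (no definitions, no named facts). Lemmas used to verify the
initial condition `∫_K |u(t) − a|² → 0` for the limit `u` of the limiting procedure
(`seregin2014_localEnergy_limitingProcedure`) when the data `a_k → a` only converge in
`L²_loc` (no uniform initial layer): the argument of Kikuchi–Seregin 2007, proof of Thm. 1.4 /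
Seregin 2014, App. B §B.4, (B.4.17)–(B.4.20): the local energy inequality from `t = 0` gives
`∫ |v_k(t)|² ψ ≤ ∫ |a_k|² ψ + ρ(t)` uniformly in `k`, this passes to the limit by weak lower
semicontinuity, and with the weak continuity at `t = 0` yields `∫ |u(t) − a|² ψ → 0`.

* `continuousOn_integral_inner_of_test_of_unitBall_bound` — pairings of a weakly continuous
  family of slices (continuous against test fields, uniformly locally `L²`) with compactly
  supported `L²` fields are continuous (density; the tree's
  `IsLocalEnergySolutionOn.continuousOn_integral_inner_of_memLp` without the solution structure);
* `lintegral_sq_smul_le_of_tendsto_integral_inner` — weak lower semicontinuity of the weighted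
  energy `∫ |θ v|²` under convergence of the pairings with test fields (duality);
* `IsLocalEnergySolutionOn.integral_sq_mul_le_of_flux_le` — for a local energy solution with a
  (gauged) local Leray pressure: `∫ |v(t)|² ψ ≤ ∫ |v₀|² ψ + ρ` for **every** `t ∈ (0, σ)` when
  the flux of the local energy inequality on `(0, σ)` is `≤ ρ` (a.e. `t` by the inequality from
  `t = 0`, every `t` by lower semicontinuity along good times).

## References

* N. Kikuchi, G. Seregin, AMS Transl. (2) 220 (2007), proof of Thm. 1.4.
* G. Seregin (2014), App. B §B.4, (B.4.17)–(B.4.20).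
-/

noncomputable section

open MeasureTheory TopologicalSpace Set Function Filter Metric
open _root_.Topology
open scoped ENNReal NNReal RealInnerProductSpace Laplacian

namespace Literature.Analysis.FluidPDE

/-! ### Products of scalar test functions with fields -/

/-- The product of a scalar test function with a smooth field is a test field. [folklore] -/
theorem isTestFunctionOn_smul_of_contDiff {θ : EuclideanSpace ℝ (Fin 3) → ℝ}
    (hθ : FunctionSpaces.IsTestFunctionOn (⊤ : Opens (EuclideanSpace ℝ (Fin 3))) θ)
    {φ : EuclideanSpace ℝ (Fin 3) → EuclideanSpace ℝ (Fin 3)} (hφ : ContDiff ℝ (⊤ : ℕ∞) φ) :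
    FunctionSpaces.IsTestFunctionOn (⊤ : Opens (EuclideanSpace ℝ (Fin 3))) fun x => θ x • φ x :=
  ⟨hθ.contDiff.smul hφ, hθ.hasCompactSupport.smul_right, fun _ _ => trivial⟩

/-- `⟪θ • f, g⟫ = ⟪f, θ • g⟫` under the integral. [folklore] -/
theorem integral_inner_smul_left_eq {f g : EuclideanSpace ℝ (Fin 3) → EuclideanSpace ℝ (Fin 3)}
    {θ : EuclideanSpace ℝ (Fin 3) → ℝ} :
    ∫ x, ⟪θ x • f x, g x⟫ = ∫ x, ⟪f x, θ x • g x⟫ := by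
  refine integral_congr_ae (Eventually.of_forall fun x => ?_)
  simp only [real_inner_smul_left, real_inner_smul_right]

/-! ### `L²` on balls from unit-ball bounds -/

/-- From unit-ball bounds to balls of radius `R` (finite cover). [folklore] -/
theorem exists_lintegral_ball_le_of_unitBall {ι : Type*} (v : ι → EuclideanSpace ℝ (Fin 3) → EuclideanSpace ℝ (Fin 3))
    {C : ℝ≥0} (hC : ∀ i, ∀ x₀ : EuclideanSpace ℝ (Fin 3), ∫⁻ x in ball x₀ 1, ‖v i x‖ₑ ^ 2 ≤ C) (R : ℝ) :
    ∃ C' : ℝ≥0, ∀ i, ∀ x₀ : EuclideanSpace ℝ (Fin 3), ∫⁻ x in ball x₀ R, ‖v i x‖ₑ ^ 2 ≤ C' := by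
  obtain ⟨F, hF⟩ := exists_finset_ball_subset_biUnion_ball_one R
  refine ⟨F.card * C, fun i x₀ => ?_⟩
  have h := lintegral_biUnion_finset_le_card_mul F (fun c => ball (x₀ + c) 1) (fun x => ‖v i x‖ₑ ^ 2)
    (μ := volume) (C := (C : ℝ≥0∞)) fun c _ => hC i (x₀ + c)
  refine (lintegral_mono_set (hF x₀)).trans (h.trans (le_of_eq ?_))
  push_cast; rfl

/-! ### Pairings with compactly supported `L²` fields -/

/-- **Weakly continuous families of uniformly locally `L²` slices pair continuously with compactly
supported `L²` fields.** If `t ↦ ∫⟪u(t), φ⟫` is continuous on `[0, T]` for every test field `φ`,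
every slice `u(t)` is measurable with `∫_{B(x₀,1)} |u(t)|² ≤ C`, and `ξ ∈ L²` vanishes off a
compact set, then `t ↦ ∫⟪u(t), ξ⟫` is continuous on `[0, T]` (approximate `ξ` in `L²(B)` by test
fields; the pairings converge uniformly on `[0, T]`). [cite: Seregin2014Notes, App. B Def. B.1 (B.1.6)] -/
theorem continuousOn_integral_inner_of_test_of_unitBall_bound {T : ℝ}
    {u : ℝ → EuclideanSpace ℝ (Fin 3) → EuclideanSpace ℝ (Fin 3)}
    (hmeas : ∀ t ∈ Icc 0 T, AEStronglyMeasurable (u t) volume) {C : ℝ≥0}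
    (hC : ∀ t ∈ Icc 0 T, ∀ x₀ : EuclideanSpace ℝ (Fin 3), ∫⁻ x in ball x₀ 1, ‖u t x‖ₑ ^ 2 ≤ C)
    (hwc : ∀ φ : EuclideanSpace ℝ (Fin 3) → EuclideanSpace ℝ (Fin 3),
      FunctionSpaces.IsTestFunctionOn (⊤ : Opens (EuclideanSpace ℝ (Fin 3))) φ →
        ContinuousOn (fun t => ∫ x, ⟪u t x, φ x⟫) (Icc 0 T))
    {ξ : EuclideanSpace ℝ (Fin 3) → EuclideanSpace ℝ (Fin 3)} (hξ : MemLp ξ 2 volume)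
    {K : Set (EuclideanSpace ℝ (Fin 3))} (hK : IsCompact K) (hξK : ∀ x ∉ K, ξ x = 0) :
    ContinuousOn (fun t => ∫ x, ⟪u t x, ξ x⟫) (Icc 0 T) := by
  obtain ⟨R, hR⟩ := hK.isBounded.subset_ball (0 : EuclideanSpace ℝ (Fin 3))
  set S : Opens (EuclideanSpace ℝ (Fin 3)) := ⟨ball 0 R, isOpen_ball⟩ with hS
  -- the `L²(B)` bound on the slices
  obtain ⟨C', hC'⟩ := exists_lintegral_ball_le_of_unitBall (fun t : Icc (0 : ℝ) T => u t) (fun t x₀ => hC t t.2 x₀) R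
  set M : ℝ≥0∞ := (C' : ℝ≥0∞) ^ (1 / 2 : ℝ) with hM
  have hMtop : M ≠ ∞ := ENNReal.rpow_ne_top_of_nonneg (by norm_num) ENNReal.coe_ne_top
  have hvS : ∀ t ∈ Icc 0 T, eLpNorm (u t) 2 (volume.restrict (ball 0 R)) ≤ M := by
    intro t ht
    rw [eLpNorm_two_eq_rpow_lintegral_sq]
    refine ENNReal.rpow_le_rpow ?_ (by norm_num)
    exact hC' ⟨t, ht⟩ 0
  have hvt2 : ∀ t ∈ Icc 0 T, MemLp (u t) 2 (volume.restrict (ball 0 R)) := fun t ht =>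
    ⟨(hmeas t ht).restrict, (hvS t ht).trans_lt hMtop.lt_top⟩
  -- the approximants
  have hξS : MemLp ξ 2 ((volume : Measure (EuclideanSpace ℝ (Fin 3))).restrict S) := hξ.restrict _
  have hpos : ∀ n : ℕ, ((n : ℝ≥0∞) + 1)⁻¹ ≠ 0 := fun n => by simp
  choose ζ hζ hζε using fun n : ℕ =>
    Literature.Analysis.FunctionSpaces.exists_isTestFunctionOn_eLpNorm_sub_le S one_le_two
      ENNReal.ofNat_ne_top hξS (hpos n)
  set g : ℝ → ℝ := fun t => ∫ x, ⟪u t x, ξ x⟫ with hg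
  set gn : ℕ → ℝ → ℝ := fun n t => ∫ x, ⟪u t x, ζ n x⟫ with hgn
  have hgn_cont : ∀ n, ContinuousOn (gn n) (Icc 0 T) := fun n => hwc (ζ n) ((hζ n).mono le_top)
  have hvanish : ∀ n x, x ∉ ball (0 : EuclideanSpace ℝ (Fin 3)) R → ξ x - ζ n x = 0 := by
    intro n x hx
    have h1 : ξ x = 0 := hξK x fun hxK => hx (hR hxK)
    have h2 : ζ n x = 0 := by
      refine image_eq_zero_of_notMem_tsupport fun hx' => hx ?_
      exact (hζ n).tsupport_subset hx'
    rw [h1, h2, sub_zero]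
  have hest : ∀ n, ∀ t ∈ Icc 0 T, |g t - gn n t| ≤ (M * ((n : ℝ≥0∞) + 1)⁻¹).toReal := by
    intro n t ht
    have hvt := hvt2 t ht
    have hζ2 : MemLp (ζ n) 2 (volume : Measure (EuclideanSpace ℝ (Fin 3))) :=
      (hζ n).contDiff.continuous.memLp_of_hasCompactSupport (hζ n).hasCompactSupport
    have hdiff : MemLp (fun x => ξ x - ζ n x) 2 (volume.restrict (ball 0 R)) := (hξ.sub hζ2).restrict _
    have hint1 : Integrable (fun x => ⟪u t x, ξ x⟫) volume := by
      have h1 : Integrable (fun x => ⟪u t x, ξ x⟫) (volume.restrict (ball 0 R)) :=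
        integrable_inner_of_memLp_two hvt (hξ.restrict _)
      refine (integrableOn_iff_integrable_of_support_subset (s := ball 0 R) ?_).1 h1
      intro x hx
      by_contra hxB
      have : ξ x = 0 := hξK x fun hxK => hxB (hR hxK)
      exact hx (by simp [this])
    have hint2 : Integrable (fun x => ⟪u t x, ζ n x⟫) volume := by
      have h1 : Integrable (fun x => ⟪u t x, ζ n x⟫) (volume.restrict (ball 0 R)) :=
        integrable_inner_of_memLp_two hvt (hζ2.restrict _)
      refine (integrableOn_iff_integrable_of_support_subset (s := ball 0 R) ?_).1 h1
      intro x hx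
      by_contra hxB
      have : ζ n x = 0 := by
        refine image_eq_zero_of_notMem_tsupport fun hx' => hxB ?_
        exact (hζ n).tsupport_subset hx'
      exact hx (by simp [this])
    have e1 : g t - gn n t = ∫ x, ⟪u t x, ξ x - ζ n x⟫ := by
      simp only [hg, hgn]
      rw [← integral_sub hint1 hint2]
      refine integral_congr_ae (Eventually.of_forall fun x => ?_)
      simp only [inner_sub_right]
    have e2 : ∫ x, ⟪u t x, ξ x - ζ n x⟫ = ∫ x in ball 0 R, ⟪u t x, ξ x - ζ n x⟫ := by
      refine (setIntegral_eq_integral_of_forall_compl_eq_zero fun x hx => ?_).symm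
      rw [hvanish n x hx, inner_zero_right]
    rw [e1, e2]
    refine (abs_integral_inner_le_of_memLp_two hvt hdiff).trans ?_
    rw [ENNReal.toReal_mul]
    refine mul_le_mul (ENNReal.toReal_mono hMtop (hvS t ht)) ?_ ENNReal.toReal_nonneg ENNReal.toReal_nonneg
    exact ENNReal.toReal_mono (by simp) (hζε n)
  have hconv : ∀ n : ℕ, (M * ((n : ℝ≥0∞) + 1)⁻¹).toReal = M.toReal * (1 / ((n : ℝ) + 1)) := by
    intro n
    have e1 : ((n : ℝ≥0∞) + 1).toReal = (n : ℝ) + 1 := by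
      rw [ENNReal.toReal_add (ENNReal.natCast_ne_top n) ENNReal.one_ne_top, ENNReal.toReal_natCast, ENNReal.toReal_one]
    rw [ENNReal.toReal_mul, ENNReal.toReal_inv, e1, one_div]
  have hδ0 : Tendsto (fun n : ℕ => M.toReal * (1 / ((n : ℝ) + 1))) atTop (𝓝 0) := by
    have h1 := tendsto_one_div_add_atTop_nhds_zero_nat.const_mul M.toReal
    rwa [mul_zero] at h1
  have hunif : TendstoUniformlyOn gn g atTop (Icc 0 T) := by
    rw [Metric.tendstoUniformlyOn_iff]
    intro ε hε
    filter_upwards [hδ0.eventually (gt_mem_nhds hε)] with n hn t ht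
    rw [Real.dist_eq]
    calc |g t - gn n t| ≤ (M * ((n : ℝ≥0∞) + 1)⁻¹).toReal := hest n t ht
      _ = M.toReal * (1 / ((n : ℝ) + 1)) := hconv n
      _ < ε := hn
  exact hunif.continuousOn (Eventually.of_forall hgn_cont).frequently

/-! ### Weak lower semicontinuity of weighted energies under convergence of pairings -/

/-- **Weighted energies are lower semicontinuous under convergence of pairings with test fields**
(duality, `eLpNorm_two_le_of_forall_isTestFunctionOn`): if `∫⟪v_i, φ⟫ → ∫⟪g, φ⟫` for every
test field, `θ` is a scalar test function, `θ g ∈ L²`, and eventually `∫ |θ v_i|² ≤ B`, then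
`∫ |θ g|² ≤ B`. [cite: Seregin2014Notes, App. B §B.4 (B.4.9)] -/
theorem lintegral_sq_smul_le_of_tendsto_integral_inner {ι : Type*} {l : Filter ι} [l.NeBot]
    {v : ι → EuclideanSpace ℝ (Fin 3) → EuclideanSpace ℝ (Fin 3)}
    {g : EuclideanSpace ℝ (Fin 3) → EuclideanSpace ℝ (Fin 3)} {θ : EuclideanSpace ℝ (Fin 3) → ℝ}
    (hθ : FunctionSpaces.IsTestFunctionOn (⊤ : Opens (EuclideanSpace ℝ (Fin 3))) θ)
    (hvm : ∀ᶠ i in l, AEStronglyMeasurable (v i) volume)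
    (hg2 : MemLp (fun x => θ x • g x) 2 volume) {B : ℝ≥0∞}
    (hB : ∀ᶠ i in l, ∫⁻ x, ‖θ x • v i x‖ₑ ^ 2 ≤ B)
    (hconv : ∀ φ : EuclideanSpace ℝ (Fin 3) → EuclideanSpace ℝ (Fin 3),
      FunctionSpaces.IsTestFunctionOn (⊤ : Opens (EuclideanSpace ℝ (Fin 3))) φ →
        Tendsto (fun i => ∫ x, ⟪v i x, φ x⟫) l (𝓝 (∫ x, ⟪g x, φ x⟫))) :
    ∫⁻ x, ‖θ x • g x‖ₑ ^ 2 ≤ B := by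
  rcases eq_or_ne B ⊤ with rfl | hBtop
  · exact le_top
  set b : ℝ := (B ^ (1 / 2 : ℝ)).toReal with hb
  have hb0 : 0 ≤ b := ENNReal.toReal_nonneg
  have hBhalf : B ^ (1 / 2 : ℝ) ≠ ⊤ := ENNReal.rpow_ne_top_of_nonneg (by norm_num) hBtop
  have hθc : Continuous θ := hθ.contDiff.continuous
  -- duality
  have key : ∀ φ : EuclideanSpace ℝ (Fin 3) → EuclideanSpace ℝ (Fin 3),
      FunctionSpaces.IsTestFunctionOn (⊤ : Opens (EuclideanSpace ℝ (Fin 3))) φ →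
        |∫ x, ⟪θ x • g x, φ x⟫| ≤ b * (eLpNorm φ 2 (volume.restrict ((⊤ : Opens (EuclideanSpace ℝ (Fin 3))) :
          Set (EuclideanSpace ℝ (Fin 3))))).toReal := by
    intro φ hφ
    have hμ : (volume.restrict ((⊤ : Opens (EuclideanSpace ℝ (Fin 3))) : Set (EuclideanSpace ℝ (Fin 3)))) =
        (volume : Measure (EuclideanSpace ℝ (Fin 3))) := by
      rw [show ((⊤ : Opens (EuclideanSpace ℝ (Fin 3))) : Set (EuclideanSpace ℝ (Fin 3))) = univ from rfl,
        Measure.restrict_univ]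
    rw [hμ]
    have hφ2 : MemLp φ 2 volume := hφ.contDiff.continuous.memLp_of_hasCompactSupport hφ.hasCompactSupport
    have hθφ : FunctionSpaces.IsTestFunctionOn (⊤ : Opens (EuclideanSpace ℝ (Fin 3))) fun x => θ x • φ x :=
      isTestFunctionOn_smul_of_contDiff hθ hφ.contDiff
    -- the pairings `∫⟪θ v_i, φ⟫ = ∫⟪v_i, θφ⟫ → ∫⟪g, θφ⟫ = ∫⟪θ g, φ⟫`
    have hlim : Tendsto (fun i => ∫ x, ⟪θ x • v i x, φ x⟫) l (𝓝 (∫ x, ⟪θ x • g x, φ x⟫)) := by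
      have h := hconv _ hθφ
      rw [integral_inner_smul_left_eq]
      refine h.congr fun i => ?_
      rw [integral_inner_smul_left_eq]
    -- eventually `|∫⟪θ v_i, φ⟫| ≤ b ‖φ‖₂`
    have hev : ∀ᶠ i in l, |∫ x, ⟪θ x • v i x, φ x⟫| ≤ b * (eLpNorm φ 2 volume).toReal := by
      filter_upwards [hvm, hB] with i him hiB
      have hvi2 : MemLp (fun x => θ x • v i x) 2 volume := by
        refine ⟨hθc.aestronglyMeasurable.smul him, ?_⟩
        rw [eLpNorm_two_eq_rpow_lintegral_sq]
        exact ENNReal.rpow_lt_top_of_nonneg (by norm_num) (hiB.trans_lt hBtop.lt_top).ne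
      refine (abs_integral_inner_le_of_memLp_two hvi2 hφ2).trans (mul_le_mul_of_nonneg_right ?_ ENNReal.toReal_nonneg)
      refine ENNReal.toReal_mono hBhalf ?_
      rw [eLpNorm_two_eq_rpow_lintegral_sq]
      exact ENNReal.rpow_le_rpow hiB (by norm_num)
    exact le_of_tendsto ((continuous_abs.tendsto _).comp hlim) hev
  have hg2' : MemLp (fun x => θ x • g x) 2 (volume.restrict ((⊤ : Opens (EuclideanSpace ℝ (Fin 3))) :
      Set (EuclideanSpace ℝ (Fin 3)))) := hg2.restrict _
  have h := eLpNorm_two_le_of_forall_isTestFunctionOn ⊤ hg2' hb0 key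
  rw [show ((⊤ : Opens (EuclideanSpace ℝ (Fin 3))) : Set (EuclideanSpace ℝ (Fin 3))) = univ from rfl,
    Measure.restrict_univ] at h
  -- square
  calc ∫⁻ x, ‖θ x • g x‖ₑ ^ 2 = eLpNorm (fun x => θ x • g x) 2 volume ^ 2 := by
        rw [lintegral_enorm_sq_eq_eLpNorm_two_sq]
    _ ≤ ENNReal.ofReal b ^ 2 := pow_le_pow_left' h 2
    _ = B := by
        rw [hb, ENNReal.ofReal_toReal hBhalf, ← ENNReal.rpow_natCast, ← ENNReal.rpow_mul]
        norm_num

/-! ### The weighted energy at every time from a flux bound -/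

/-- **The weighted energy of a local energy solution is controlled at every time by the datum and
the flux** (Seregin 2014, Remark B.3 with (B.1.10) from `t₀ = 0`; Kikuchi–Seregin 2007, proof of
Thm. 1.4). Let `(v, π)` be a local energy solution on `ℝ³ × (0,T)` (`ν = 1`) and `π'` a (gauged)
pressure with `(v, π')` a local Leray solution on the slab; let `ψ ≥ 0` be smooth with
`tsupport ψ ⊆ B(0, r)`, `v₀ ∈ L²` against `ψ`, `0 < σ ≤ T`, and assume the flux bound
`∫∫_{(0,σ)×B_r} | |v|²Δψ + (|v|² + 2π') v·∇ψ | ≤ ρ < ∞`. Then for **every** `t ∈ (0, σ)`,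
`∫ |v(t)|² ψ ≤ ∫ |v₀|² ψ + ρ`. [cite: Seregin2014Notes, App. B Remark B.3 (B.1.10)] -/
theorem IsLocalEnergySolutionOn.integral_sq_mul_le_of_flux_le {T : ℝ}
    {v₀ : EuclideanSpace ℝ (Fin 3) → EuclideanSpace ℝ (Fin 3)}
    {v : ℝ → EuclideanSpace ℝ (Fin 3) → EuclideanSpace ℝ (Fin 3)} {π π' : ℝ → EuclideanSpace ℝ (Fin 3) → ℝ}
    (h : IsLocalEnergySolutionOn T 1 v₀ v π) (hL : IsLocalLeraySolutionOn T 1 v₀ v π')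
    (hm₀ : AEStronglyMeasurable v₀ volume)
    {G : ℝ → EuclideanSpace ℝ (Fin 3) → EuclideanSpace ℝ (Fin 3) →L[ℝ] EuclideanSpace ℝ (Fin 3)}
    (hG : HasWeakSpatialGradientOn (slab (EuclideanSpace ℝ (Fin 3)) (Ioo 0 T) isOpen_Ioo) v G)
    {ψ : EuclideanSpace ℝ (Fin 3) → ℝ} {r : ℝ} (hψ : ContDiff ℝ (⊤ : ℕ∞) ψ) (hψc : HasCompactSupport ψ)
    (hψs : tsupport ψ ⊆ ball 0 r) (hψ0 : ∀ x, 0 ≤ ψ x)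
    (hv₀ : Integrable (fun x => ‖v₀ x‖ ^ 2 * ψ x) volume)
    {σ : ℝ} (hσ : 0 < σ) (hσT : σ ≤ T) {ρ : ℝ≥0∞} (hρ : ρ ≠ ⊤)
    (hflux : ∫⁻ z in Ioo 0 σ ×ˢ ball (0 : EuclideanSpace ℝ (Fin 3)) r,
      ‖‖v z.1 z.2‖ ^ 2 * Δ ψ z.2 + (‖v z.1 z.2‖ ^ 2 + 2 * π' z.1 z.2) * ⟪v z.1 z.2, gradient ψ z.2⟫‖ₑ ≤ ρ) :
    ∀ t ∈ Ioo 0 σ, ∫ x, ‖v t x‖ ^ 2 * ψ x ≤ (∫ x, ‖v₀ x‖ ^ 2 * ψ x) + ρ.toReal := by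
  have hT : 0 < T := hσ.trans_le hσT
  -- ## a.e. `s ∈ (0, σ)`: the local energy inequality from `t = 0`
  have hae := hL.ae_lintegral_sq_mul_add_grad_le_datum_add hm₀ hG hσ hσT hψ hψs hψ0
  have hX₀ : ∫⁻ x, ‖v₀ x‖ₑ ^ 2 * ENNReal.ofReal (ψ x) = ENNReal.ofReal (∫ x, ‖v₀ x‖ ^ 2 * ψ x) := by
    rw [ofReal_integral_eq_lintegral_ofReal hv₀ (ae_of_all _ fun x => mul_nonneg (sq_nonneg _) (hψ0 x))]
    refine lintegral_congr fun x => ?_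
    rw [ENNReal.ofReal_mul (sq_nonneg _), ← ofReal_norm, ENNReal.ofReal_pow (norm_nonneg _)]
  have hae' : ∀ᵐ s ∂(volume.restrict (Ioo 0 σ)), ∫ x, ‖v s x‖ ^ 2 * ψ x ≤ (∫ x, ‖v₀ x‖ ^ 2 * ψ x) + ρ.toReal := by
    filter_upwards [hae, ae_restrict_mem measurableSet_Ioo] with s hs hsI
    have hsT : s ∈ Icc 0 T := ⟨hsI.1.le, hsI.2.le.trans hσT⟩
    have hint := h.integrable_sq_mul hsT hψ.continuous hψc
    have hXs : ∫⁻ x, ‖v s x‖ₑ ^ 2 * ENNReal.ofReal (ψ x) = ENNReal.ofReal (∫ x, ‖v s x‖ ^ 2 * ψ x) := by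
      rw [ofReal_integral_eq_lintegral_ofReal hint (ae_of_all _ fun x => mul_nonneg (sq_nonneg _) (hψ0 x))]
      refine lintegral_congr fun x => ?_
      rw [ENNReal.ofReal_mul (sq_nonneg _), ← ofReal_norm, ENNReal.ofReal_pow (norm_nonneg _)]
    -- drop the dissipation, bound the flux over `(0,s)` by that over `(0,σ)`
    have h1 : ENNReal.ofReal (∫ x, ‖v s x‖ ^ 2 * ψ x) ≤ ENNReal.ofReal (∫ x, ‖v₀ x‖ ^ 2 * ψ x) + ρ := by
      calc ENNReal.ofReal (∫ x, ‖v s x‖ ^ 2 * ψ x) = ∫⁻ x, ‖v s x‖ₑ ^ 2 * ENNReal.ofReal (ψ x) := hXs.symm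
        _ ≤ (∫⁻ x, ‖v s x‖ₑ ^ 2 * ENNReal.ofReal (ψ x)) +
            2 * ∫⁻ z in Ioo 0 s ×ˢ ball (0 : EuclideanSpace ℝ (Fin 3)) r,
              ENNReal.ofReal (frobeniusNormSq (G z.1 z.2)) * ENNReal.ofReal (ψ z.2) := le_self_add
        _ ≤ _ := hs
        _ ≤ ENNReal.ofReal (∫ x, ‖v₀ x‖ ^ 2 * ψ x) + ρ := by
            rw [hX₀]
            refine add_le_add le_rfl ((lintegral_mono_set (Set.prod_mono (Ioo_subset_Ioo_right hsI.2.le) Subset.rfl)).trans hflux)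
    have h0 : 0 ≤ ∫ x, ‖v₀ x‖ ^ 2 * ψ x := integral_nonneg fun x => mul_nonneg (sq_nonneg _) (hψ0 x)
    rw [← ENNReal.ofReal_toReal hρ, ← ENNReal.ofReal_add h0 ENNReal.toReal_nonneg] at h1
    exact (ENNReal.ofReal_le_ofReal_iff (add_nonneg h0 ENNReal.toReal_nonneg)).1 h1
  -- ## every `t ∈ (0, σ)`: good times `s_j ↓ t` and lower semicontinuity
  intro t ht
  have hae'' : ∀ᵐ s ∂(volume : Measure ℝ), s ∈ Ioo t σ → ∫ x, ‖v s x‖ ^ 2 * ψ x ≤ (∫ x, ‖v₀ x‖ ^ 2 * ψ x) + ρ.toReal := by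
    have h1 := (ae_restrict_iff' (measurableSet_Ioo : MeasurableSet (Ioo (0 : ℝ) σ))).1 hae'
    filter_upwards [h1] with s hs hsI
    exact hs ⟨ht.1.trans hsI.1, hsI.2⟩
  obtain ⟨s, hs, hslim⟩ := exists_seq_Ioo_tendsto_of_ae ht.2 hae''
  have hsT : ∀ j, s j ∈ Icc 0 T := fun j => ⟨(ht.1.trans (hs j).1.1).le, ((hs j).1.2.le.trans hσT)⟩
  have htT : t ∈ Icc 0 T := ⟨ht.1.le, (ht.2.le.trans hσT)⟩
  refine le_of_forall_pos_le_add fun ε hε => ?_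
  have hev := h.integral_sq_mul_le_add_of_tendsto hψ.continuous hψc hψ0 htT hsT hslim hε
  obtain ⟨j, hj⟩ := hev.exists
  calc ∫ x, ‖v t x‖ ^ 2 * ψ x ≤ (∫ x, ‖v (s j) x‖ ^ 2 * ψ x) + ε := hj
    _ ≤ (∫ x, ‖v₀ x‖ ^ 2 * ψ x) + ρ.toReal + ε := add_le_add (hs j).2 le_rfl

/-! ### The smooth cut-offs `θ_d`, `ψ_d = θ_d²` -/

/-- The cut-off `θ_d(x) = χ₁(x − d)`: a scalar test function with values in `[0,1]`, `= 1` on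
`B(d,1)`, supported in `B̄(d,2) ⊆ B(0, ‖d‖ + 3)`. [folklore] -/
theorem cutoff_shift_props (d : EuclideanSpace ℝ (Fin 3)) :
    FunctionSpaces.IsTestFunctionOn (⊤ : Opens (EuclideanSpace ℝ (Fin 3)))
        (fun x => cutoff (E := EuclideanSpace ℝ (Fin 3)) 1 (x - d)) ∧
      (∀ x, 0 ≤ cutoff (E := EuclideanSpace ℝ (Fin 3)) 1 (x - d)) ∧
      (∀ x, cutoff (E := EuclideanSpace ℝ (Fin 3)) 1 (x - d) ≤ 1) ∧
      (∀ x ∈ ball d 1, cutoff (E := EuclideanSpace ℝ (Fin 3)) 1 (x - d) = 1) ∧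
      (∀ x, cutoff (E := EuclideanSpace ℝ (Fin 3)) 1 (x - d) ≠ 0 → x ∈ ball d 3) ∧
      tsupport (fun x => cutoff (E := EuclideanSpace ℝ (Fin 3)) 1 (x - d)) ⊆ ball 0 (‖d‖ + 3) := by
  have hcd : ContDiff ℝ (⊤ : ℕ∞) fun x : EuclideanSpace ℝ (Fin 3) => cutoff (E := EuclideanSpace ℝ (Fin 3)) 1 (x - d) :=
    (contDiff_cutoff 1).comp (contDiff_id.sub contDiff_const)
  have hzero : ∀ x : EuclideanSpace ℝ (Fin 3), 2 ≤ ‖x - d‖ → cutoff (E := EuclideanSpace ℝ (Fin 3)) 1 (x - d) = 0 :=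
    fun x hx => cutoff_eq_zero one_pos (by linarith)
  have hsupp : Function.support (fun x : EuclideanSpace ℝ (Fin 3) => cutoff (E := EuclideanSpace ℝ (Fin 3)) 1 (x - d)) ⊆
      closedBall d 2 := by
    intro x hx
    rw [mem_closedBall, dist_eq_norm]
    by_contra h
    exact hx (hzero x (not_le.1 h).le)
  have htsupp : tsupport (fun x : EuclideanSpace ℝ (Fin 3) => cutoff (E := EuclideanSpace ℝ (Fin 3)) 1 (x - d)) ⊆ closedBall d 2 :=
    closure_minimal hsupp isClosed_closedBall
  have hcs : HasCompactSupport fun x : EuclideanSpace ℝ (Fin 3) => cutoff (E := EuclideanSpace ℝ (Fin 3)) 1 (x - d) :=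
    HasCompactSupport.of_support_subset_isCompact (isCompact_closedBall d 2) hsupp
  refine ⟨⟨hcd, hcs, fun _ _ => trivial⟩, fun x => cutoff_nonneg _ _, fun x => cutoff_le_one _ _,
    fun x hx => cutoff_eq_one one_pos ?_, fun x hx => ?_, htsupp.trans fun x hx => ?_⟩
  · rw [mem_ball, dist_eq_norm] at hx; exact hx.le
  · rw [mem_ball, dist_eq_norm]
    by_contra h
    exact hx (hzero x (by linarith [not_lt.1 h]))
  · rw [mem_closedBall, dist_eq_norm] at hx
    rw [mem_ball_zero_iff]
    calc ‖x‖ = ‖(x - d) + d‖ := by rw [sub_add_cancel]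
      _ ≤ ‖x - d‖ + ‖d‖ := norm_add_le _ _
      _ < ‖d‖ + 3 := by linarith

end Literature.Analysis.FluidPDE
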